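import Summits.HodgeConjecture.CorCM.MultiFieldWeilDecoupling
import HarnessLib

/-!
# MULTI-FIELD WEIL ENGINE — THE RANKED TRANSFER: the signed equations of a tuple set pass to the unit-wise product of its images when the units can be RANKED so that
# every unit needs movers only for the units BELOW it, and a `2`-TRANSITIVE unit needs NOTHING for the units below it with fewer letters (census level)

Cell `pub-hodgecm2` (COR-CM), seat b30 gen 41 (2026-08-26); count-neutral own lane MULTI-FIELD WEIL ENGINE (stem `MultiFieldWeil*`), census level, the sequel of
`CorCM/MultiFieldWeilDecoupling.lean` (D1: irreducibility; orthogonality of the centred signed slot sums of a `2`-transitive slot and a slot with fewer letters) and the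
replacement of `CorCM/MultiFieldWeilTwinUnits.lean` §1 `signed_transfer_units` (movers in BOTH directions between every two units).  Theorems only; no definition, no
named fact, no `sorry`, no `decide`.  HONEST FRAMING: pure finite combinatorics ∕ linear algebra over `ℚ`; `HC_CM` is NOT touched.

SETTING.  `R ⊆ ∏_m Sym(n_m)` non-empty, closed under products and inverses, transitive on every slot; the slots are grouped into UNITS (the fibres of `U`); `E_m(σ) =
Σ_a ±_{σ a ∈ P_m} d_m(a)` the signed slot sums of integer functions `d_m`, `A_m = (2|P_m| − n_m)(Σ d_m)/n_m` their averages, `X_m(σ) = E_m(σ) − A_m` the CENTRED signed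
slot sums, `c_u(π) = Σ_{m ∈ u} X_m(π_m)` the centred sum of a unit.  The signed equations `e + Σ_m E_m(π_m) = 0` (`π ∈ R`) say `Σ_u c_u ≡ 0` on `R`; the TRANSFER to the
unit-wise product `R' = {π' : π'|_u ∈ R|_u ∀ u}` is the statement `c_u ≡ 0` on `R` for every unit `u`.
* §1 **ELIMINATION OF ONE UNIT** (`unit_centredSum_eq_zero`).  Let `u₀` be a unit and suppose `Σ_{u live} c_u ≡ 0` on `R` for a set of live units containing `u₀` such that
  every other live unit `u` EITHER admits movers trivial on `u₀` (for every slot `m ∈ u` and letters `a, a'` a tuple of `R` equal to `1` on `u₀` with `a ↦ a'` at `m`) OR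
  has all its slots with fewer letters than the slots of `u₀`, the latter being `2`-TRANSITIVE.  Then `c_{u₀} ≡ 0` on `R`.  PROOF: average the identity over the class
  `C(ρ) = {π ∈ R : π|_{u₀} = ρ|_{u₀}}`: the mover units average to `0` (uniform fibres, `sum_signed_slot_eq_card_mul`), so `|C(ρ)|·c_{u₀}(ρ) = −Σ_{π ∈ C(ρ)} B(π)` with `B`
  the centred sum of the small units; hence `Σ_ρ c_{u₀}(ρ)² = −Σ_π c_{u₀}(π) B(π)` (class averaging, `sum_sum_div_card_eq`) `= 0` by D1's orthogonality — a sum of squares.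
* §2 **THE RANKED TRANSFER** (`signed_transfer_units_ranked`).  A rank `rk` constant on units; HYPOTHESIS per ordered pair of distinct units `(u₀, u)` with `rk u ≤ rk u₀`:
  movers of `u` trivial on `u₀`, OR (`u₀` `2`-transitive and `u` has fewer letters).  Then the signed equations transfer to the unit-wise product (eliminate the units from
  the top rank down, §1 with live = rank `≤` the current one).  With `rk` constant this is `signed_transfer_units` (movers both ways); with `rk = ` number of letters it
  says: MOVERS ARE ONLY NEEDED DOWNWARDS, AND NOT AT ALL BELOW A `2`-TRANSITIVE UNIT — e.g. an `𝔄₄`/`𝔖₄`-octic unit needs nothing against sextic units (the hypothesis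
  «a value of the sextic field outside the closure of the octic field», false when the cubic part is the resolvent, is GONE), a decic unit with `2`-transitive quintic
  part needs nothing against octic and sextic units.
* §3 **THE DEFECT LAW WITH RANKED UNITS** (`exists_hasDefectsG_of_unitsRanked`): U2's `exists_hasDefectsG_of_unitsStabiliserTransitive` with `hstab` replaced by the ranked
  hypothesis (apply U2 to the unit-wise product `R'`, where movers are free, after transferring balancedness by §2).
[cite: Serre1977, §2.2 Cor. 2–3 of Prop. 4; §2.3 Ex. 2.6] [cite: MoonenZarhin1995Duke, Thm. 2.4] [cite: GaoUllmo2025, Thm 3.1] [cite: DixonMortimer1996, §1.4 Ex. 1.4.1–1.4.2; §2.1]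
[cite: Lang2002, XIII §4]

## References
* [Serre1977] J.-P. Serre, *Linear Representations of Finite Groups*, GTM 42, §2.2–§2.3.  [MoonenZarhin1995Duke] B. Moonen, Yu. Zarhin, Duke Math. J. 77 (1995), Thm. 2.4.
  [GaoUllmo2025] Z. Gao, E. Ullmo, J. Inst. Math. Jussieu 25 (2025), Thm 3.1.  [DixonMortimer1996] J. D. Dixon, B. Mortimer, *Permutation Groups*, GTM 163, §1.4, §2.1.
  [Lang2002] S. Lang, *Algebra*, GTM 211, XIII §4.
-/

noncomputable section

namespace Summit.HodgeConjecture.CorCM.MultiFieldWeil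

open Finset
open Summit.HodgeConjecture.CorCM.Census.MultiFieldWeil

open scoped Classical

/-! ## §0 Class averaging -/

/-- **Class averaging.**  A family of classes `cl x ⊆ R` with `x ∈ cl x` and `cl y = cl x` for `y ∈ cl x`: `Σ_{x ∈ R} (Σ_{y ∈ cl x} F y)/|cl x| = Σ_{y ∈ R} F y`. [folklore] -/
theorem sum_sum_div_card_eq {α : Type} (R : Finset α) (cl : α → Finset α) (hsub : ∀ x ∈ R, cl x ⊆ R) (hmem : ∀ x ∈ R, x ∈ cl x)
    (hcl : ∀ x ∈ R, ∀ y ∈ cl x, cl y = cl x) (F : α → ℚ) : ∑ x ∈ R, (∑ y ∈ cl x, F y) / (cl x).card = ∑ y ∈ R, F y := by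
  have hsymm : ∀ x ∈ R, ∀ y ∈ R, y ∈ cl x ↔ x ∈ cl y := by
    intro x hx y hy
    constructor
    · intro h; rw [hcl x hx y h]; exact hmem x hx
    · intro h; rw [hcl y hy x h]; exact hmem y hy
  calc ∑ x ∈ R, (∑ y ∈ cl x, F y) / (cl x).card = ∑ x ∈ R, ∑ y ∈ cl x, F y / (cl y).card := by
        refine Finset.sum_congr rfl fun x hx => ?_
        rw [Finset.sum_div]
        exact Finset.sum_congr rfl fun y hy => by rw [hcl x hx y hy]
    _ = ∑ x ∈ R, ∑ y ∈ R, (if y ∈ cl x then F y / (cl y).card else 0) := by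
        refine Finset.sum_congr rfl fun x hx => ?_
        rw [← Finset.sum_filter]
        congr 1
        ext y
        simp only [Finset.mem_filter]
        exact ⟨fun h => ⟨hsub x hx h, h⟩, fun h => h.2⟩
    _ = ∑ y ∈ R, ∑ x ∈ R, (if y ∈ cl x then F y / (cl y).card else 0) := Finset.sum_comm
    _ = ∑ y ∈ R, F y := by
        refine Finset.sum_congr rfl fun y hy => ?_
        rw [← Finset.sum_filter, Finset.sum_const, nsmul_eq_mul]
        have hset : (R.filter fun x => y ∈ cl x) = cl y := by
          ext x
          simp only [Finset.mem_filter]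
          exact ⟨fun h => (hsymm x h.1 y hy).1 h.2, fun h => ⟨hsub y hy h, (hsymm x (hsub y hy h) y hy).2 h⟩⟩
        rw [hset]
        have h0 : ((cl y).card : ℚ) ≠ 0 := by exact_mod_cast (Finset.card_pos.2 ⟨y, hmem y hy⟩).ne'
        field_simp

section Model

variable {r : ℕ} {n : Fin r → ℕ} {R : Finset (PermsG n)} {P : ∀ m : Fin r, Finset (Fin (n m))}

/-! ## §1 Elimination of one unit -/

/-- **ELIMINATION OF ONE UNIT.**  See the module docstring, §1: if the centred signed sums of the live slots vanish identically on `R`, the live slots contain the unit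
of `m₀`, and every live slot outside that unit either has movers trivial on the unit of `m₀` or has fewer letters than the (then `2`-transitive) slots of the unit of
`m₀`, then the centred sum of the unit of `m₀` vanishes identically on `R`. [cite: Serre1977, §2.2 Cor. 2–3 of Prop. 4] [cite: MoonenZarhin1995Duke, Thm. 2.4]
[cite: DixonMortimer1996, §1.4 Ex. 1.4.1–1.4.2; §2.1] -/
theorem unit_centredSum_eq_zero (U : Fin r → Fin r) (hmul : ∀ π ∈ R, ∀ π' ∈ R, π * π' ∈ R) (hinv : ∀ π ∈ R, π⁻¹ ∈ R) (hne : R.Nonempty) (m₀ : Fin r)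
    (live : Finset (Fin r)) (hlive : ∀ m, U m = U m₀ → m ∈ live)
    (hpair : ∀ m ∈ live, U m ≠ U m₀ →
      (∀ a a' : Fin (n m), ∃ ν ∈ R, (∀ m', U m' = U m₀ → ν m' = 1) ∧ ν m a = a') ∨
      (∀ m', U m' = U m₀ → (∀ a a' b b' : Fin (n m'), a ≠ a' → b ≠ b' → ∃ π ∈ R, π m' a = b ∧ π m' a' = b') ∧ n m < n m'))
    {d : ∀ m : Fin r, Fin (n m) → ℤ}
    (hE : ∀ π ∈ R, ∑ m ∈ live, ((((∑ a : Fin (n m), (if π m a ∈ P m then d m a else -d m a)) : ℤ) : ℚ) -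
      (2 * ((P m).card : ℚ) - n m) * (∑ a : Fin (n m), (d m a : ℚ)) / n m) = 0) :
    ∀ ρ ∈ R, ∑ m ∈ Finset.univ.filter (fun m => U m = U m₀), ((((∑ a : Fin (n m), (if ρ m a ∈ P m then d m a else -d m a)) : ℤ) : ℚ) -
      (2 * ((P m).card : ℚ) - n m) * (∑ a : Fin (n m), (d m a : ℚ)) / n m) = 0 := by
  -- notation
  set X : ∀ m : Fin r, Equiv.Perm (Fin (n m)) → ℚ := fun m σ => ((((∑ a : Fin (n m), (if σ a ∈ P m then d m a else -d m a)) : ℤ) : ℚ) -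
      (2 * ((P m).card : ℚ) - n m) * (∑ a : Fin (n m), (d m a : ℚ)) / n m) with hX
  set unit : Finset (Fin r) := Finset.univ.filter (fun m => U m = U m₀) with hunit
  set c₀ : PermsG n → ℚ := fun π => ∑ m ∈ unit, X m (π m) with hc₀
  show ∀ ρ ∈ R, c₀ ρ = 0
  -- the classes `C ρ = {π ∈ R : π = ρ on the unit of m₀}`
  set C : PermsG n → Finset (PermsG n) := fun ρ => R.filter fun π => ∀ m, U m = U m₀ → π m = ρ m with hC
  have hCR : ∀ ρ, C ρ ⊆ R := fun ρ => Finset.filter_subset _ _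
  have hmemC : ∀ ρ π, π ∈ C ρ ↔ π ∈ R ∧ ∀ m, U m = U m₀ → π m = ρ m := fun ρ π => Finset.mem_filter
  have hselfC : ∀ ρ ∈ R, ρ ∈ C ρ := fun ρ hρ => (hmemC ρ ρ).2 ⟨hρ, fun _ _ => rfl⟩
  have hCC : ∀ ρ ∈ R, ∀ π ∈ C ρ, C π = C ρ := by
    intro ρ _ π hπ
    obtain ⟨-, hπρ⟩ := (hmemC ρ π).1 hπ
    ext π₁
    simp only [hmemC]
    exact ⟨fun h => ⟨h.1, fun m hm => (h.2 m hm).trans (hπρ m hm)⟩, fun h => ⟨h.1, fun m hm => (h.2 m hm).trans (hπρ m hm).symm⟩⟩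
  have hc₀C : ∀ ρ, ∀ π ∈ C ρ, c₀ π = c₀ ρ := by
    intro ρ π hπ
    obtain ⟨-, hπρ⟩ := (hmemC ρ π).1 hπ
    exact Finset.sum_congr rfl fun m hm => by rw [hπρ m (Finset.mem_filter.1 hm).2]
  -- the mover slots and the small slots among the live slots outside the unit
  set Sa : Finset (Fin r) := live.filter fun m => U m ≠ U m₀ ∧ ∀ a a' : Fin (n m), ∃ ν ∈ R, (∀ m', U m' = U m₀ → ν m' = 1) ∧ ν m a = a' with hSa
  set Sb : Finset (Fin r) := live.filter fun m => U m ≠ U m₀ ∧ ¬ ∀ a a' : Fin (n m), ∃ ν ∈ R, (∀ m', U m' = U m₀ → ν m' = 1) ∧ ν m a = a' with hSb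
  have hSb : ∀ m ∈ Sb, ∀ m', U m' = U m₀ → (∀ a a' b b' : Fin (n m'), a ≠ a' → b ≠ b' → ∃ π ∈ R, π m' a = b ∧ π m' a' = b') ∧ n m < n m' := by
    intro m hm
    obtain ⟨hml, hmU, hno⟩ := Finset.mem_filter.1 hm
    exact (hpair m hml hmU).resolve_left hno
  set B : PermsG n → ℚ := fun π => ∑ m ∈ Sb, X m (π m) with hB
  -- splitting the live sum: unit + Sa + Sb
  have hsplit : ∀ π : PermsG n, (∑ m ∈ live, X m (π m)) = c₀ π + ∑ m ∈ Sa, X m (π m) + B π := by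
    intro π
    rw [← Finset.sum_filter_add_sum_filter_not live (fun m => U m = U m₀)]
    have hu : live.filter (fun m => U m = U m₀) = unit := by
      ext m
      simp only [Finset.mem_filter, hunit, Finset.mem_univ, true_and]
      exact ⟨fun h => h.2, fun h => ⟨hlive m h, h⟩⟩
    rw [hu, ← Finset.sum_filter_add_sum_filter_not (live.filter fun m => ¬ U m = U m₀)
      (fun m => ∀ a a' : Fin (n m), ∃ ν ∈ R, (∀ m', U m' = U m₀ → ν m' = 1) ∧ ν m a = a'), Finset.filter_filter, Finset.filter_filter, add_assoc]
  -- (1) mover slots average to zero over every class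
  have hSa0 : ∀ ρ ∈ R, ∀ m ∈ Sa, (∑ π ∈ C ρ, X m (π m)) = 0 := by
    intro ρ hρ m hm
    obtain ⟨-, -, hmov⟩ := Finset.mem_filter.1 hm
    have hunif : ∀ a a' : Fin (n m), ((C ρ).filter fun π => π m a ∈ P m).card = ((C ρ).filter fun π => π m a' ∈ P m).card :=
      card_filter_apply_mem_eq_of_movers (C ρ) (fun a a' => by
        obtain ⟨ν, hν, hν₀, hνa⟩ := hmov a' a
        refine ⟨ν, fun π hπ => ?_, hνa⟩
        rw [hmemC] at hπ ⊢
        exact ⟨hmul π hπ.1 ν hν, fun m' hm' => by rw [Pi.mul_apply, hν₀ m' hm', mul_one, hπ.2 m' hm']⟩) (P m)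
    have hs := sum_signed_slot_eq_card_mul (P := P) (C ρ) m (d m) hunif
    simp only [hX]
    rw [Finset.sum_sub_distrib, hs, Finset.sum_const, nsmul_eq_mul, sub_self]
  -- (2) `|C ρ| · c₀ ρ = − Σ_{π ∈ C ρ} B π`
  have hstep1 : ∀ ρ ∈ R, ((C ρ).card : ℚ) * c₀ ρ = -∑ π ∈ C ρ, B π := by
    intro ρ hρ
    have h1 : ∑ π ∈ C ρ, (∑ m ∈ live, X m (π m)) = 0 := Finset.sum_eq_zero fun π hπ => hE π (hCR ρ hπ)
    rw [Finset.sum_congr rfl fun π _ => hsplit π, Finset.sum_add_distrib, Finset.sum_add_distrib,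
      Finset.sum_congr rfl fun π hπ => hc₀C ρ π hπ, Finset.sum_const, nsmul_eq_mul, Finset.sum_comm,
      Finset.sum_eq_zero fun m hm => hSa0 ρ hρ m hm, add_zero] at h1
    linarith
  -- (3) small slots are orthogonal to the unit
  have hSb0 : ∑ π ∈ R, c₀ π * B π = 0 := by
    simp only [hB, hc₀, Finset.sum_mul, Finset.mul_sum]
    rw [Finset.sum_comm]
    refine Finset.sum_eq_zero fun m' hm' => ?_
    rw [Finset.sum_comm]
    refine Finset.sum_eq_zero fun m hm => ?_
    obtain ⟨h2t, hlt⟩ := hSb m' hm' m (Finset.mem_filter.1 hm).2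
    have h : ∑ π ∈ R, X m' (π m') * X m (π m) = 0 := sum_centredSigned_mul_eq_zero (P := P) hmul hinv hne hlt h2t (d m') (d m)
    exact (Finset.sum_congr rfl fun π _ => mul_comm (X m (π m)) (X m' (π m'))).trans h
  -- (4) the sum of squares vanishes
  have hsq : ∑ ρ ∈ R, c₀ ρ * c₀ ρ = 0 := by
    have h1 : ∀ ρ ∈ R, c₀ ρ * c₀ ρ = -((∑ π ∈ C ρ, c₀ π * B π) / (C ρ).card) := by
      intro ρ hρ
      have hc : ((C ρ).card : ℚ) ≠ 0 := by exact_mod_cast (Finset.card_pos.2 ⟨ρ, hselfC ρ hρ⟩).ne'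
      have h3 : c₀ ρ = -(∑ π ∈ C ρ, B π) / (C ρ).card := by
        rw [eq_div_iff hc, mul_comm]
        linarith [hstep1 ρ hρ]
      calc c₀ ρ * c₀ ρ = c₀ ρ * (-(∑ π ∈ C ρ, B π) / (C ρ).card) := by rw [← h3]
        _ = -((∑ π ∈ C ρ, c₀ ρ * B π) / (C ρ).card) := by rw [← Finset.mul_sum]; ring
        _ = -((∑ π ∈ C ρ, c₀ π * B π) / (C ρ).card) :=
            congrArg (fun t => -(t / ((C ρ).card : ℚ))) (Finset.sum_congr rfl fun π hπ => by rw [hc₀C ρ π hπ])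
    rw [Finset.sum_congr rfl h1, Finset.sum_neg_distrib, sum_sum_div_card_eq R C (fun ρ _ => hCR ρ) hselfC hCC (fun π => c₀ π * B π), hSb0, neg_zero]
  -- conclude
  intro ρ hρ
  have h := (Finset.sum_eq_zero_iff_of_nonneg fun π _ => mul_self_nonneg (c₀ π)).1 hsq ρ hρ
  exact mul_self_eq_zero.1 h

/-! ## §2 The ranked transfer -/

/-- **THE RANKED TRANSFER ACROSS UNITS.**  `R ⊆ ∏_m Sym(n_m)` non-empty, closed under products and inverses, transitive on every slot; slots grouped into units by `U`;
a rank `rk` constant on units; for every two slots `m₀, m` in DIFFERENT units with `rk m ≤ rk m₀`: EITHER some tuple of `R` is the identity on the whole unit of `m₀`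
and carries `a` to `a'` at `m` (all `a, a'`), OR every slot of the unit of `m₀` is `2`-transitive under `R` with more letters than `m`.  If the signed equations
`u + Σ_m Σ_a (±_{π_m a ∈ P_m} d_m a) = 0` hold at every `π ∈ R`, they hold at every tuple `π'` that agrees unit-wise with tuples of `R`.  (`rk` constant:
`signed_transfer_units`.) [cite: Serre1977, §2.2 Cor. 2–3 of Prop. 4; §2.3 Ex. 2.6] [cite: MoonenZarhin1995Duke, Thm. 2.4] [cite: GaoUllmo2025, Thm 3.1]
[cite: DixonMortimer1996, §1.4 Ex. 1.4.1–1.4.2; §2.1] -/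
theorem signed_transfer_units_ranked (U : Fin r → Fin r) (hmul : ∀ π ∈ R, ∀ π' ∈ R, π * π' ∈ R) (hinv : ∀ π ∈ R, π⁻¹ ∈ R) (hne : R.Nonempty)
    (htrans : ∀ (m : Fin r) (a a' : Fin (n m)), ∃ π ∈ R, π m a = a')
    (rk : Fin r → ℕ) (hrk : ∀ m m' : Fin r, U m' = U m → rk m' = rk m)
    (hpair : ∀ m₀ m : Fin r, U m ≠ U m₀ → rk m ≤ rk m₀ →
      (∀ a a' : Fin (n m), ∃ ν ∈ R, (∀ m', U m' = U m₀ → ν m' = 1) ∧ ν m a = a') ∨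
      (∀ m', U m' = U m₀ → (∀ a a' b b' : Fin (n m'), a ≠ a' → b ≠ b' → ∃ π ∈ R, π m' a = b ∧ π m' a' = b') ∧ n m < n m'))
    {u : ℤ} {d : ∀ m : Fin r, Fin (n m) → ℤ}
    (h : ∀ π ∈ R, u + ∑ m : Fin r, ∑ a : Fin (n m), (if π m a ∈ P m then d m a else -d m a) = 0)
    (π' : PermsG n) (hπ' : ∀ m₀ : Fin r, ∃ π ∈ R, ∀ m, U m = U m₀ → π m = π' m) :
    u + ∑ m : Fin r, ∑ a : Fin (n m), (if π' m a ∈ P m then d m a else -d m a) = 0 := by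
  -- notation: the signed slot sums `E`, their averages `A`, the centred sums `X = E − A`, the unit sums `c`
  set E : ∀ m : Fin r, Equiv.Perm (Fin (n m)) → ℤ := fun m σ => ∑ a : Fin (n m), (if σ a ∈ P m then d m a else -d m a) with hE
  set A : Fin r → ℚ := fun m => (2 * ((P m).card : ℚ) - n m) * (∑ a : Fin (n m), (d m a : ℚ)) / n m with hA
  have hEdef : ∀ (m : Fin r) (σ : Equiv.Perm (Fin (n m))), E m σ = ∑ a : Fin (n m), (if σ a ∈ P m then d m a else -d m a) := fun _ _ => rfl
  set c : Fin r → PermsG n → ℚ := fun m₀ π => ∑ m ∈ Finset.univ.filter (fun m => U m = U m₀), ((E m (π m) : ℚ) - A m) with hc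
  -- (1) over all of `R`: `u + Σ_m A_m = 0`, so the centred sums add up to zero on `R`
  have hunifR : ∀ (m : Fin r) (a a' : Fin (n m)), (R.filter fun π => π m a ∈ P m).card = (R.filter fun π => π m a' ∈ P m).card := fun m =>
    card_filter_apply_mem_eq_of_movers R (fun a a' => by
      obtain ⟨ν, hν, hνa⟩ := htrans m a' a
      exact ⟨ν, fun π hπ => hmul π hπ ν hν, hνa⟩) (P m)
  have hsumR : ∀ m : Fin r, (∑ π ∈ R, (E m (π m) : ℚ)) = (R.card : ℚ) * A m := fun m => by
    simp only [hEdef, hA]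
    exact sum_signed_slot_eq_card_mul R m (d m) (hunifR m)
  have hRpos : (0 : ℚ) < R.card := by exact_mod_cast Finset.card_pos.2 hne
  have hstar : (u : ℚ) + ∑ m : Fin r, A m = 0 := by
    have h1 : ∑ π ∈ R, ((u : ℚ) + ∑ m : Fin r, (E m (π m) : ℚ)) = 0 := by
      refine Finset.sum_eq_zero fun π hπ => ?_
      have := h π hπ
      simp only [← hEdef] at this
      exact_mod_cast this
    rw [Finset.sum_add_distrib, Finset.sum_const, Finset.sum_comm, Finset.sum_congr rfl fun m _ => hsumR m, ← Finset.mul_sum, nsmul_eq_mul,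
      ← mul_add] at h1
    exact (mul_eq_zero.1 h1).resolve_left hRpos.ne'
  have hXsum : ∀ π ∈ R, ∑ m : Fin r, ((E m (π m) : ℚ) - A m) = 0 := by
    intro π hπ
    have h1 := h π hπ
    simp only [← hEdef] at h1
    have h2 : ((u : ℚ) + ∑ m : Fin r, (E m (π m) : ℚ)) = 0 := by exact_mod_cast h1
    rw [Finset.sum_sub_distrib]
    linarith
  -- sums over unions of units, unit by unit
  have hfib : ∀ (D : Finset (Fin r)) (π : PermsG n), (∀ m m', U m' = U m → m ∈ D → m' ∈ D) → (∀ m ∈ D, c m π = 0) →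
      ∑ m ∈ D, ((E m (π m) : ℚ) - A m) = 0 := by
    intro D π hD hzero
    rw [← Finset.sum_fiberwise_of_maps_to (s := D) (t := Finset.univ) (g := U) fun m _ => Finset.mem_univ (U m)]
    refine Finset.sum_eq_zero fun v _ => ?_
    by_cases hv : ∃ m₁ ∈ D, U m₁ = v
    · obtain ⟨m₁, hm₁, rfl⟩ := hv
      rw [← hzero m₁ hm₁]
      refine Finset.sum_congr ?_ fun _ _ => rfl
      ext m
      simp only [Finset.mem_filter, Finset.mem_univ, true_and]
      exact ⟨fun hm => hm.2, fun hm => ⟨hD m₁ m hm hm₁, hm⟩⟩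
    · exact Finset.sum_eq_zero fun m hm => absurd ⟨m, (Finset.mem_filter.1 hm).1, (Finset.mem_filter.1 hm).2⟩ hv
  -- (2) every unit sum vanishes on `R`: eliminate the units from the top rank down
  have hall : ∀ (s : ℕ) (m₀ : Fin r), Finset.univ.sup rk + 1 ≤ rk m₀ + s → ∀ ρ ∈ R, c m₀ ρ = 0 := by
    intro s
    induction s with
    | zero =>
      intro m₀ hs
      have := Finset.le_sup (f := rk) (Finset.mem_univ m₀)
      omega
    | succ s ih =>
      intro m₀ hs
      -- the units above `m₀` are already eliminated
      have habove : ∀ m, rk m₀ < rk m → ∀ ρ ∈ R, c m ρ = 0 := fun m hm => ih m (by omega)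
      -- eliminate the unit of `m₀` among the live slots `rk ≤ rk m₀`
      refine unit_centredSum_eq_zero (P := P) U hmul hinv hne m₀ (Finset.univ.filter fun m => rk m ≤ rk m₀)
        (fun m hm => Finset.mem_filter.2 ⟨Finset.mem_univ m, (hrk m₀ m hm).le⟩)
        (fun m hm hU => hpair m₀ m hU (Finset.mem_filter.1 hm).2) (d := d) fun π hπ => ?_
      have htot := hXsum π hπ
      rw [← Finset.sum_filter_add_sum_filter_not Finset.univ (fun m => rk m ≤ rk m₀)] at htot
      have hdead : ∑ m ∈ Finset.univ.filter (fun m => ¬ rk m ≤ rk m₀), ((E m (π m) : ℚ) - A m) = 0 :=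
        hfib _ π (fun m m' hmm hm => by
          have h1 := (Finset.mem_filter.1 hm).2
          exact Finset.mem_filter.2 ⟨Finset.mem_univ m', by rw [hrk m m' hmm]; exact h1⟩)
          (fun m hm => habove m (by have := (Finset.mem_filter.1 hm).2; omega) π hπ)
      rw [hdead, add_zero] at htot
      simp only [hEdef] at htot
      exact htot
  have hunits : ∀ (m₀ : Fin r), ∀ ρ ∈ R, c m₀ ρ = 0 := fun m₀ => hall (Finset.univ.sup rk + 1) m₀ (by omega)
  -- (3) conclude: the centred sums of `π'` vanish unit by unit
  have hfin : ∑ m : Fin r, ((E m (π' m) : ℚ) - A m) = 0 := by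
    refine hfib Finset.univ π' (fun _ _ _ _ => Finset.mem_univ _) fun m₁ _ => ?_
    obtain ⟨π₁, hπ₁, hπ₁e⟩ := hπ' m₁
    rw [← hunits m₁ π₁ hπ₁]
    exact Finset.sum_congr rfl fun m hm => by rw [hπ₁e m (Finset.mem_filter.1 hm).2]
  rw [Finset.sum_sub_distrib, sub_eq_zero] at hfin
  have : ((u + ∑ m : Fin r, E m (π' m) : ℤ) : ℚ) = 0 := by push_cast; rw [hfin]; exact hstar
  have h' : u + ∑ m : Fin r, E m (π' m) = 0 := by exact_mod_cast this
  simpa only [hEdef] using h'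

/-! ## §3 The defect law with ranked units -/

/-- **THE DEFECT LAW WITH RANKED UNITS.**  U2's `exists_hasDefectsG_of_unitsStabiliserTransitive` (units = fibres of `U`, one size and diagonal tuples inside a unit,
`2`-transitive on units with two or more slots, independent centred indicators, the slot menu on single slots) with its cross-unit hypothesis `hstab` (movers in both
directions between every two units) REPLACED by the ranked hypothesis of `signed_transfer_units_ranked`: movers only downwards in rank, and none at all below a
`2`-transitive unit towards units with fewer letters.  (Transfer balancedness to the unit-wise product `R'`, where movers are free, and apply U2 to `R'`.)
[cite: Serre1977, §2.2 Cor. 2–3 of Prop. 4; §2.3 Ex. 2.6] [cite: MoonenZarhin1995Duke, Thm. 2.4] [cite: GaoUllmo2025, Thm 3.1]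
[cite: DixonMortimer1996, §1.4 Ex. 1.4.1–1.4.2; §1.6, Thm. 1.6A; §2.1] [cite: Lang2002, XIII §4] -/
theorem exists_hasDefectsG_of_unitsRanked (hmul : ∀ π ∈ R, ∀ π' ∈ R, π * π' ∈ R) (hinv : ∀ π ∈ R, π⁻¹ ∈ R) (hne : R.Nonempty)
    (htrans : ∀ (m : Fin r) (a a' : Fin (n m)), ∃ π ∈ R, π m a = a')
    (U : Fin r → Fin r) (hn : ∀ m m' : Fin r, U m' = U m → n m' = n m)
    (hdiag : ∀ π ∈ R, ∀ (m m' : Fin r) (h : U m' = U m) (a : Fin (n m')), Fin.cast (hn m m' h) (π m' a) = π m (Fin.cast (hn m m' h) a))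
    (h2t : ∀ m, (∃ m', m' ≠ m ∧ U m' = U m) → ∀ a a' b b' : Fin (n m), a ≠ a' → b ≠ b' → ∃ π ∈ R, π m a = b ∧ π m a' = b')
    (rk : Fin r → ℕ) (hrk : ∀ m m' : Fin r, U m' = U m → rk m' = rk m)
    (hpair : ∀ m₀ m : Fin r, U m ≠ U m₀ → rk m ≤ rk m₀ →
      (∀ a a' : Fin (n m), ∃ ν ∈ R, (∀ m', U m' = U m₀ → ν m' = 1) ∧ ν m a = a') ∨
      (∀ m', U m' = U m₀ → (∀ a a' b b' : Fin (n m'), a ≠ a' → b ≠ b' → ∃ π ∈ R, π m' a = b ∧ π m' a' = b') ∧ n m < n m'))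
    (hkind : ∀ m, (∀ m', U m' = U m → m' = m) → ((n m).Prime ∧ (P m).Nonempty ∧ (P m).card < n m) ∨ (P m).card = 1 ∨
      ((0 < (P m).card ∧ (P m).card < n m) ∧ ∀ Q : Finset (Fin (n m)), Q.card = (P m).card → ∃ π ∈ R, preG (π m) (P m) = Q))
    (hli : ∀ m, (∃ m', m' ≠ m ∧ U m' = U m) → LinearIndependent ℚ fun m' : {m' : Fin r // U m' = U m} => fun q : Fin (n m) =>
      ((n m : ℚ) * (if q ∈ (P m'.1).image (Fin.cast (hn m m'.1 m'.2)) then 1 else 0) - (P m'.1).card))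
    (c : Fin r → ℕ) (hc : ∀ m, ((c m : ℕ) : ℤ) = (n m : ℤ) - 2 * (P m).card)
    {α : Type} (v : α → PtG n) (T : Finset α) (hT : ModelBalancedG P R v T) : ∃ t : Fin r → ℤ, HasDefectsG c v T t := by
  have h1R : (1 : PermsG n) ∈ R := one_mem_of_closed hmul hinv hne
  -- the unit-wise product `R'`
  set R' : Finset (PermsG n) := Finset.univ.filter fun π' => ∀ m₀, ∃ π ∈ R, ∀ m, U m = U m₀ → π m = π' m with hR'
  have hmemR' : ∀ π' : PermsG n, π' ∈ R' ↔ ∀ m₀, ∃ π ∈ R, ∀ m, U m = U m₀ → π m = π' m := fun π' => by simp [hR']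
  have hRR' : R ⊆ R' := fun π hπ => (hmemR' π).2 fun m₀ => ⟨π, hπ, fun _ _ => rfl⟩
  have hmul' : ∀ π ∈ R', ∀ π' ∈ R', π * π' ∈ R' := fun π₁ h₁ π₂ h₂ => (hmemR' _).2 fun m₀ => by
    obtain ⟨ρ₁, hρ₁, e₁⟩ := (hmemR' π₁).1 h₁ m₀
    obtain ⟨ρ₂, hρ₂, e₂⟩ := (hmemR' π₂).1 h₂ m₀
    exact ⟨ρ₁ * ρ₂, hmul _ hρ₁ _ hρ₂, fun m hm => by rw [Pi.mul_apply, Pi.mul_apply, e₁ m hm, e₂ m hm]⟩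
  have hinv' : ∀ π ∈ R', π⁻¹ ∈ R' := fun π₁ h₁ => (hmemR' _).2 fun m₀ => by
    obtain ⟨ρ, hρ, e⟩ := (hmemR' π₁).1 h₁ m₀
    exact ⟨ρ⁻¹, hinv _ hρ, fun m hm => by rw [Pi.inv_apply, Pi.inv_apply, e m hm]⟩
  have hne' : R'.Nonempty := hne.mono hRR'
  -- hybrids: a tuple of `R` on the unit of `m`, the identity elsewhere, lies in `R'`
  have hhyb : ∀ (m : Fin r) (π : PermsG n), π ∈ R → (fun m' => if U m' = U m then π m' else 1) ∈ R' := by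
    intro m π hπ
    rw [hmemR']
    intro m₀
    by_cases hm₀ : U m₀ = U m
    · refine ⟨π, hπ, fun m' hm' => ?_⟩
      simp only [hm'.trans hm₀, if_true]
    · refine ⟨1, h1R, fun m' hm' => ?_⟩
      have : U m' ≠ U m := fun h => hm₀ (hm'.symm.trans h)
      simp only [this, if_false, Pi.one_apply]
  have hdiag' : ∀ π ∈ R', ∀ (m m' : Fin r) (h : U m' = U m) (a : Fin (n m')), Fin.cast (hn m m' h) (π m' a) = π m (Fin.cast (hn m m' h) a) := by
    intro π hπ m m' h a
    obtain ⟨ρ, hρ, hρe⟩ := (hmemR' π).1 hπ m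
    rw [← hρe m rfl, ← hρe m' h]
    exact hdiag ρ hρ m m' h a
  -- movers are FREE in `R'`
  have hstab' : ∀ (m₀ m : Fin r), U m₀ ≠ U m → ∀ a a' : Fin (n m), ∃ ν ∈ R', (∀ m', U m' = U m₀ → ν m' = 1) ∧ ν m a = a' := by
    intro m₀ m hU a a'
    obtain ⟨π, hπ, hπa⟩ := htrans m a a'
    refine ⟨fun m' => if U m' = U m then π m' else 1, hhyb m π hπ, fun m' hm' => ?_, ?_⟩
    · have : U m' ≠ U m := fun h => hU (hm'.symm.trans h)
      simp only [this, if_false]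
    · simp only [if_true, hπa]
  -- balancedness transfers to `R'` (§2)
  have hT' : ModelBalancedG P R' v T := fun π' hπ' =>
    balancedG_of_signed v (signed_transfer_units_ranked (P := P) U hmul hinv hne htrans rk hrk hpair (fun π hπ => signed_of_modelBalancedG R v hT hπ) π'
      ((hmemR' π').1 hπ'))
  -- U2 on `R'`
  exact exists_hasDefectsG_of_unitsStabiliserTransitive hmul' hinv' hne' (fun m a a' => by obtain ⟨π, hπ, h⟩ := htrans m a a'; exact ⟨π, hRR' hπ, h⟩) U hn hdiag'
    (fun m hm a a' b b' hab hab' => by obtain ⟨π, hπ, h₁, h₂⟩ := h2t m hm a a' b b' hab hab'; exact ⟨π, hRR' hπ, h₁, h₂⟩) hstab'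
    (fun m hm => by
      rcases hkind m hm with h | h | ⟨h, hQ⟩
      · exact Or.inl h
      · exact Or.inr (Or.inl h)
      · exact Or.inr (Or.inr ⟨h, fun Q hQc => by obtain ⟨π, hπ, e⟩ := hQ Q hQc; exact ⟨π, hRR' hπ, e⟩⟩))
    hli c hc v T hT'

end Model

/-! ## §4 The realised reading -/

section Realised

variable {I : Type} {r : ℕ} {Kf : I → Type} [∀ i, Field (Kf i)] [∀ i, NumberField (Kf i)] {i₀ : I} {is : Fin r → I} {n : Fin r → ℕ}
  {e : ∀ m : Fin r, (Kf (is m) →+* ℂ) ≃ Fin (n m) × Bool} {τ : Kf i₀ →+* ℂ} {im : ∀ m : Fin r, Kf i₀ →+* Kf (is m)}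
  (he_sign : ∀ (m : Fin r) (s : Kf (is m) →+* ℂ), (e m s).2 = true ↔ s.comp (im m) = τ)

include he_sign in
/-- **THE DEFECT LAW FOR REALISED TUPLES WITH RANKED UNITS** (U3's `exists_hasDefectsG_realisedTuples_of_units` with `hstab` replaced by the ranked hypothesis:
movers only downwards in rank, none below a `2`-transitive unit towards units with fewer letters). [cite: MoonenZarhin1995Duke, Thm. 2.4] [cite: Shimura1998, §18.2 Lemma (i)]
[cite: Serre1977, §2.2 Cor. 2–3 of Prop. 4; §2.3 Ex. 2.6] [cite: DixonMortimer1996, §1.4 Ex. 1.4.1–1.4.2; §1.6 and Thm. 1.6A; §2.1] [cite: Lang2002, XIII §4] -/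
theorem exists_hasDefectsG_realisedTuples_of_unitsRanked
    (U : Fin r → Fin r) (hn : ∀ m m' : Fin r, U m' = U m → n m' = n m)
    (hdiag : ∀ π ∈ realisedTuples e τ, ∀ (m m' : Fin r) (h : U m' = U m) (a : Fin (n m')), Fin.cast (hn m m' h) (π m' a) = π m (Fin.cast (hn m m' h) a))
    (h2t : ∀ m, (∃ m', m' ≠ m ∧ U m' = U m) → ∀ a a' b b' : Fin (n m), a ≠ a' → b ≠ b' → ∃ π ∈ realisedTuples e τ, π m a = b ∧ π m a' = b')
    (rk : Fin r → ℕ) (hrk : ∀ m m' : Fin r, U m' = U m → rk m' = rk m)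
    (hpair : ∀ m₀ m : Fin r, U m ≠ U m₀ → rk m ≤ rk m₀ →
      (∀ a a' : Fin (n m), ∃ ν ∈ realisedTuples e τ, (∀ m', U m' = U m₀ → ν m' = 1) ∧ ν m a = a') ∨
      (∀ m', U m' = U m₀ → (∀ a a' b b' : Fin (n m'), a ≠ a' → b ≠ b' → ∃ π ∈ realisedTuples e τ, π m' a = b ∧ π m' a' = b') ∧ n m < n m'))
    {P : ∀ m : Fin r, Finset (Fin (n m))}
    (hkind : ∀ m, (∀ m', U m' = U m → m' = m) → ((n m).Prime ∧ (P m).Nonempty ∧ (P m).card < n m) ∨ (P m).card = 1 ∨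
      ((0 < (P m).card ∧ (P m).card < n m) ∧ ∀ Q : Finset (Fin (n m)), Q.card = (P m).card → ∃ π ∈ realisedTuples e τ, preG (π m) (P m) = Q))
    (hli : ∀ m, (∃ m', m' ≠ m ∧ U m' = U m) → LinearIndependent ℚ fun m' : {m' : Fin r // U m' = U m} => fun q : Fin (n m) =>
      ((n m : ℚ) * (if q ∈ (P m'.1).image (Fin.cast (hn m m'.1 m'.2)) then 1 else 0) - (P m'.1).card))
    (c : Fin r → ℕ) (hc : ∀ m, ((c m : ℕ) : ℤ) = (n m : ℤ) - 2 * (P m).card)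
    {α : Type} (v : α → PtG n) (T : Finset α) (hT : ModelBalancedG P (realisedTuples e τ) v T) : ∃ t : Fin r → ℤ, HasDefectsG c v T t :=
  exists_hasDefectsG_of_unitsRanked (fun _ hπ _ hπ' => mul_mem_realisedTuples e τ hπ hπ') (fun _ hπ => inv_mem_realisedTuples hπ)
    (realisedTuples_nonempty (e := e) he_sign) (fun m a b => transitive_realisedTuples (e := e) he_sign m a b) U hn hdiag h2t rk hrk hpair hkind hli c hc v T hT

end Realised

end Summit.HodgeConjecture.CorCM.MultiFieldWeil

end
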